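import Summits.Ventures.PercRepro.Night2LineLarge
import Summits.Ventures.PercRepro.Night2LineLongCell

/-!
# night-2: h21's cell `(2, 1)` whenever `V` has `24` collinear points (gen 38)

If a line `cl {a′, b′}` carries `≥ 24` points of `V = G ∖ K`, then either `V` has `≤ 100` points off the line (the long-line cell,
`localShadowHall_two_one_of_long_line`) or `|G| ≥ 125 ≥ 44` (the large-`G` theorem, `localShadowHall_two_one_of_large`):
**`localShadowHall_two_one_of_twentyfour_collinear`**.  Paper: proofs/NIGHT-2-g38.md §4.
-/

namespace PercRepro.Shadow

open PercRepro.ThmH PercRepro.PerFlat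

variable {α : Type*} [DecidableEq α] {M : Matroid α} [M.Finite] {G : Finset α}

/-- **h21's cell `(2, 1)` whenever `V` has `24` collinear points** (every size). -/
theorem localShadowHall_two_one_of_twentyfour_collinear (hG : G ∈ flatsQ M (5 + 1)) (hd : (gr M \ G).card = 2)
    (hk : kColoops M G = 1) (hs : ∀ e ∈ gr M, ∀ f ∈ gr M, e ≠ f → rkN M {e, f} = 2)
    (hl : ∀ e ∈ gr M, M.Indep {e}) {a' b' : α} (ha' : a' ∈ G \ coloops M G) (hb' : b' ∈ G \ coloops M G)
    (hab' : a' ≠ b') (hlong : 24 ≤ ((G \ coloops M G) ∩ clF M {a', b'}).card) : LocalShadowHall M 5 G := by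
  rcases Nat.lt_or_ge ((G \ coloops M G) \ clF M {a', b'}).card 101 with hlt | hge
  · exact localShadowHall_two_one_of_long_line hG hd hk hs hl ha' hb' hab' hlong (by omega)
  · apply localShadowHall_two_one_of_large hG hd hk hs hl
    have h1 := Finset.card_le_card (Finset.sdiff_subset : (G \ coloops M G) \ clF M {a', b'} ⊆ G \ coloops M G)
    have h2 := Finset.card_le_card (Finset.sdiff_subset : G \ coloops M G ⊆ G)
    omega

end PercRepro.Shadow
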